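import Mathlib
import Summits.AtomisticToContinuum.FouriersLaw.Theses.EmbeddedDrudeMourre
import HarnessLib

/-!
# A determinant-floor inequality for three-term gradient decompositions
# (stub B1b″ of line `kinetic-polymer-gas-on-the-time-axis`, triple-point step of the gradient floor (C4))
(crux `EmbeddedDrudeMourre.DrudeDissolution`, item stmt-AtomisticToContinuum-12593; `--supports` file, closes
nothing; lead c13)

WHAT. `sumSq_lincomb3_ge_of_det`: for three coordinate vectors `u, v, w ∈ ℝ³` with entries bounded by `B` and
determinant `Δ = u·(v×w)`, every linear combination satisfies
`Δ²(α² + β² + γ²) ≤ 36 B⁴ ‖αu + βv + γw‖²` (sum of squares of the three coordinates). At a triple point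
`T = (±κ*, ±κ*, ±κ*)` the gradient of `Ω = σ·A·S₁·S₂` is `σ(S₁S₂∇A + AS₂∇S₁ + AS₁∇S₂)` and the three gradients
`∇S₁, ∇S₂, ∇A` are linearly independent (`Δ = −(∇A·(1,1,1))/4·… ≠ 0`, `sheetFn_diag_deriv_ne_zero`), so this
inequality with `(α,β,γ) = (AS₂, AS₁, S₁S₂)` is the algebraic half of the local floor
`|∇Ω|² ≥ c·(A²S₂² + A²S₁² + S₁²S₂²) = c·m²` near `T`.

HOW. Cramer's rule as polynomial identities, `α·Δ = y·(v×w)` etc. with `y = αu + βv + γw` (`ring`), then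
`|yⱼ·cofactor| ≤ 2B²|yⱼ|` and `(|y₁|+|y₂|+|y₃|)² ≤ 3‖y‖²`.
-/

noncomputable section

namespace Summit.AtomisticToContinuum.FouriersLaw.Theorems.DrudeDissolution.KineticPolymerGasOnTheTimeAxis

/-- A `2 × 2` cofactor of a matrix with entries bounded by `B` is bounded by `2B²`. [folklore] -/
theorem abs_cofactor_le {a b c d B : ℝ} (ha : |a| ≤ B) (hb : |b| ≤ B) (hc : |c| ≤ B) (hd : |d| ≤ B) :
    |a * d - b * c| ≤ 2 * B ^ 2 := by
  have hB : 0 ≤ B := (abs_nonneg a).trans ha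
  calc |a * d - b * c| ≤ |a * d| + |b * c| := abs_sub _ _
    _ = |a| * |d| + |b| * |c| := by rw [abs_mul, abs_mul]
    _ ≤ B * B + B * B := add_le_add (mul_le_mul ha hd (abs_nonneg _) hB) (mul_le_mul hb hc (abs_nonneg _) hB)
    _ = 2 * B ^ 2 := by ring

/-- One Cramer coordinate: if `x·Δ = y₁c₁ + y₂c₂ + y₃c₃` with `|cⱼ| ≤ 2B²`, then
`Δ²x² ≤ 12B⁴(y₁² + y₂² + y₃²)`. [folklore] -/
theorem cramer_coordinate_sq_le {x Δ y₁ y₂ y₃ c₁ c₂ c₃ B : ℝ}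
    (h : x * Δ = y₁ * c₁ + y₂ * c₂ + y₃ * c₃)
    (h1 : |c₁| ≤ 2 * B ^ 2) (h2 : |c₂| ≤ 2 * B ^ 2) (h3 : |c₃| ≤ 2 * B ^ 2) :
    Δ ^ 2 * x ^ 2 ≤ 12 * B ^ 4 * (y₁ ^ 2 + y₂ ^ 2 + y₃ ^ 2) := by
  have habs : |x * Δ| ≤ 2 * B ^ 2 * (|y₁| + |y₂| + |y₃|) := by
    rw [h]
    calc |y₁ * c₁ + y₂ * c₂ + y₃ * c₃| ≤ |y₁ * c₁| + |y₂ * c₂| + |y₃ * c₃| := abs_add_three _ _ _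
      _ = |y₁| * |c₁| + |y₂| * |c₂| + |y₃| * |c₃| := by rw [abs_mul, abs_mul, abs_mul]
      _ ≤ |y₁| * (2 * B ^ 2) + |y₂| * (2 * B ^ 2) + |y₃| * (2 * B ^ 2) :=
          add_le_add (add_le_add (mul_le_mul_of_nonneg_left h1 (abs_nonneg _))
            (mul_le_mul_of_nonneg_left h2 (abs_nonneg _))) (mul_le_mul_of_nonneg_left h3 (abs_nonneg _))
      _ = 2 * B ^ 2 * (|y₁| + |y₂| + |y₃|) := by ring
  have hsq : (x * Δ) ^ 2 ≤ (2 * B ^ 2 * (|y₁| + |y₂| + |y₃|)) ^ 2 := by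
    have h0 : 0 ≤ |x * Δ| := abs_nonneg _
    have := pow_le_pow_left₀ h0 habs 2
    rwa [sq_abs] at this
  have h3sq : (|y₁| + |y₂| + |y₃|) ^ 2 ≤ 3 * (y₁ ^ 2 + y₂ ^ 2 + y₃ ^ 2) := by
    have e1 := sq_abs y₁
    have e2 := sq_abs y₂
    have e3 := sq_abs y₃
    nlinarith [sq_nonneg (|y₁| - |y₂|), sq_nonneg (|y₂| - |y₃|), sq_nonneg (|y₁| - |y₃|)]
  have hB4 : 0 ≤ 4 * B ^ 4 := by positivity
  calc Δ ^ 2 * x ^ 2 = (x * Δ) ^ 2 := by ring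
    _ ≤ (2 * B ^ 2 * (|y₁| + |y₂| + |y₃|)) ^ 2 := hsq
    _ = 4 * B ^ 4 * (|y₁| + |y₂| + |y₃|) ^ 2 := by ring
    _ ≤ 4 * B ^ 4 * (3 * (y₁ ^ 2 + y₂ ^ 2 + y₃ ^ 2)) := mul_le_mul_of_nonneg_left h3sq hB4
    _ = 12 * B ^ 4 * (y₁ ^ 2 + y₂ ^ 2 + y₃ ^ 2) := by ring

/-- **Registered sub-goal `sumSq_lincomb3_ge_of_det`: the determinant floor for three-term linear combinations
in coordinates.** If the nine entries of `u, v, w ∈ ℝ³` are bounded by `B` in absolute value and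
`Δ = u₁(v₂w₃ − v₃w₂) + u₂(v₃w₁ − v₁w₃) + u₃(v₁w₂ − v₂w₁)` is their determinant, then for all `α β γ`:
`Δ²(α² + β² + γ²) ≤ 36B⁴((αu₁+βv₁+γw₁)² + (αu₂+βv₂+γw₂)² + (αu₃+βv₃+γw₃)²)`. [folklore] -/
theorem sumSq_lincomb3_ge_of_det :
    ∀ (u₁ u₂ u₃ v₁ v₂ v₃ w₁ w₂ w₃ B : ℝ),
      |u₁| ≤ B → |u₂| ≤ B → |u₃| ≤ B → |v₁| ≤ B → |v₂| ≤ B → |v₃| ≤ B → |w₁| ≤ B → |w₂| ≤ B → |w₃| ≤ B →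
      ∀ α β γ : ℝ,
        (u₁ * (v₂ * w₃ - v₃ * w₂) + u₂ * (v₃ * w₁ - v₁ * w₃) + u₃ * (v₁ * w₂ - v₂ * w₁)) ^ 2 *
            (α ^ 2 + β ^ 2 + γ ^ 2) ≤
          36 * B ^ 4 * ((α * u₁ + β * v₁ + γ * w₁) ^ 2 + (α * u₂ + β * v₂ + γ * w₂) ^ 2 +
            (α * u₃ + β * v₃ + γ * w₃) ^ 2) := by
  intro u₁ u₂ u₃ v₁ v₂ v₃ w₁ w₂ w₃ B hu₁ hu₂ hu₃ hv₁ hv₂ hv₃ hw₁ hw₂ hw₃ α β γ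
  set Δ := u₁ * (v₂ * w₃ - v₃ * w₂) + u₂ * (v₃ * w₁ - v₁ * w₃) + u₃ * (v₁ * w₂ - v₂ * w₁) with hΔ
  set y₁ := α * u₁ + β * v₁ + γ * w₁ with hy₁
  set y₂ := α * u₂ + β * v₂ + γ * w₂ with hy₂
  set y₃ := α * u₃ + β * v₃ + γ * w₃ with hy₃
  -- Cramer's rule: `αΔ = y·(v×w)`, `βΔ = y·(w×u)`, `γΔ = y·(u×v)`
  have hα : α * Δ = y₁ * (v₂ * w₃ - v₃ * w₂) + y₂ * (v₃ * w₁ - v₁ * w₃) + y₃ * (v₁ * w₂ - v₂ * w₁) := by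
    rw [hΔ, hy₁, hy₂, hy₃]; ring
  have hβ : β * Δ = y₁ * (w₂ * u₃ - w₃ * u₂) + y₂ * (w₃ * u₁ - w₁ * u₃) + y₃ * (w₁ * u₂ - w₂ * u₁) := by
    rw [hΔ, hy₁, hy₂, hy₃]; ring
  have hγ : γ * Δ = y₁ * (u₂ * v₃ - u₃ * v₂) + y₂ * (u₃ * v₁ - u₁ * v₃) + y₃ * (u₁ * v₂ - u₂ * v₁) := by
    rw [hΔ, hy₁, hy₂, hy₃]; ring
  have eα := cramer_coordinate_sq_le hα (abs_cofactor_le hv₂ hv₃ hw₂ hw₃) (abs_cofactor_le hv₃ hv₁ hw₃ hw₁)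
    (abs_cofactor_le hv₁ hv₂ hw₁ hw₂)
  have eβ := cramer_coordinate_sq_le hβ (abs_cofactor_le hw₂ hw₃ hu₂ hu₃) (abs_cofactor_le hw₃ hw₁ hu₃ hu₁)
    (abs_cofactor_le hw₁ hw₂ hu₁ hu₂)
  have eγ := cramer_coordinate_sq_le hγ (abs_cofactor_le hu₂ hu₃ hv₂ hv₃) (abs_cofactor_le hu₃ hu₁ hv₃ hv₁)
    (abs_cofactor_le hu₁ hu₂ hv₁ hv₂)
  have hsplit : Δ ^ 2 * (α ^ 2 + β ^ 2 + γ ^ 2) = Δ ^ 2 * α ^ 2 + Δ ^ 2 * β ^ 2 + Δ ^ 2 * γ ^ 2 := by ring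
  rw [hsplit]
  linarith [eα, eβ, eγ]

end Summit.AtomisticToContinuum.FouriersLaw.Theorems.DrudeDissolution.KineticPolymerGasOnTheTimeAxis

end
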